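import Summits.QuantumFields.YangMills.Theorems.BalabanUVNodesK0Stub1FlatChartDImplicit
import Summits.QuantumFields.YangMills.Theorems.UnitScaleTiltProp8ChartDoubleBarStar
import HarnessLib

/-!
# K0⁷ STUB 1 (`stub_prop8StepCoP13`), S4b ♭ road — **REALITY OF THE ♭ CHART AT THE FIBRE `M_N(ℂ)`**: `Q♭(A⋆) = Q♭(A)⋆` on the read territory ∕ the weighted ball of the (152)
# weights, `Q_lin♭(A⋆) = Q_lin♭(A)⋆`, `C♭(A⋆) = C♭(A)⋆`, and — by the uniqueness clause of the implicit ♭ chart (FILE α p629502) — `Dsel♭ A′` and `A′ − H♭(Dsel♭A′)` self-adjoint at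
# self-adjoint `A′`.  The `Fin N` PORT of route `UnitScaleTilt`'s `Prop8ChartDoubleBarStar` (stated there for `M₂(ℂ)`); its engines `eml_star_inv`∕`mlog_star_inv` [B15AveragingHolomorphic],
# `norm_dbarIterU_sub_one_le_two_mul₀`, `norm_dbarAvgU_sub_one_le`, `holT_rel_of_walk` are `Fin N`∕`𝔸`-generic and used BY NAME; the K0 weighted-ball letter is n07-w2's
# `N07ChartRemainderP.norm_expCfg_sub_one_le_of_weightedBall`, the (57) shift is UST `Chart47Analytic.size_shift_lt_of_size_le`.
Cell `pub-ymgap`, width seat `pub-ymgap-k0-s1-w4` g2 (CLAIM-5, bus 2026-08-28T11:58Z).  `--kind proof --supports stmt-QuantumFields-20541 --as helper`; count-neutral.  [15] = [Balaban1985Variational].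
WHY.  The Sect. F W-slot Socket at instance (S) (`Qlin♭, H♭, Dsel♭, M♭`) delivers `W` as a gradient built from `Dsel♭`, `H♭`, `M♭`; k0-s1-w1's A₁ line wants `W X` skew-Hermitian ∕ traceless
(`hWA`∕`hWtr`), which k0-s1-w2's `K0Stub1RealityFromCertificate` derives from the REALITY of the ingredients; `H♭`, `M♭`, `Qlin♭` have real kernels, and this file supplies the nonlinear one:
print p.307's involution `θ : a ↦ (a⋆)⁻¹` passes through `e^{iη·}`, transporters, `exp[mean log]`, the block frames and the double-bar tower.
WHAT IS PROVED (sorry-free; no definition; fibre `M_N(ℂ)`, `N ≥ 1`, generic `P`).  §1 `theta_one∕_mul∕_inv∕_emlUnit`, ★ `theta_dbarAvgU`, ★★ `theta_dbarIterU_of_reads`, `coe_expCfg_star`;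
§2 ★★ `chartLogFlat_star_of_reads`, `fderiv_chartLogFlat_zero_star`, ★★ `isSelfAdjoint_dressed_of_unique` (abstract (49) + uniqueness ⇒ self-adjointness); §3 ★★ `chartLogFlat_star_weightedBall_P`
(`IsLevWeight`, collar, `60800ℓ²LR ≤ 1`, `w₁‖A‖ < R`), `chartRemainderFlat_star_weightedBall_P`, `star_apply_of_realKernelC`, ★★★ `isSelfAdjoint_chartDFlat` (generic `P`, `Adm22 D R′ M`, `2L ≤ R′`,
`1 ≤ M`; every ℂ-linear `H` with a real kernel and the sup (46) row; FILE α's window and `Dsel♭` spec on the `ε`-ball; bondwise self-adjoint `A′` ⇒ `Dsel♭ A′`, `A′ − H(Dsel♭A′)` self-adjoint).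
HONEST SCOPE.  A port ∕ bookkeeping over kernel-checked engines; nothing of [15] ∕ [B7] asserted; the `hWA`∕`hWtr` junction itself is NOT here; `stub_prop8StepCoP13` ∕ K0⁷ NOT closed; N07 NOT
discharged; no summit statement is proved by this seat; counts unmoved (28∕28 · 5∕27); one finite 𝕋⁴ programme at fixed ε — R4 closes the conditional finite-𝕋⁴ rung only; the YM mass
gap (Clay) is NOT proved by any of this; nothing continuum ∕ ℝ⁴ ∕ OS.  No `sorry`, no `def`, no `instance`, no `notation`.
References: [15] (20) p.281, (44)–(49) pp.285–286, (55)–(57) p.286, (152) p.301, p.307; [Balaban1985Averaging] (23) p.21, (110) p.34, Prop. 4 p.38; [Balaban1987RG1] (0.4)–(0.5) p.253.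
-/

set_option autoImplicit false

noncomputable section

open scoped BigOperators
open NormedSpace

namespace Summit.QuantumFields.YangMills.Theorems.K0Stub1FlatChartStar

open Literature.MathematicalPhysics.QuantumFieldTheory.Balaban1983to89
open T4Continuum BlockAveraging AveragingRT ExpMeanLog MatrixLog
open B10Eq27TorusAxialLog (holT holT_nil holT_cons_true holT_cons_false)
open B5Eq118OneStroke (iterBlockOf iterBlockOf_succ iterBlockOf_zero)
open B6SectADomainsV1 (Domains)
open B6SectAOperatorsV1 (BondIdx)
open LatticeFieldCalculus (bondAvgIter)
open Summit.QuantumFields.YangMills.Theorems.FlatCubeOpsText (Adm22)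
open Summit.QuantumFields.YangMills.Theorems.K0FlatCubeOpsTextP (IsLevWeight)
open Summit.QuantumFields.YangMills.Theorems.Prop8Chart
open Summit.QuantumFields.YangMills.Theorems.Prop8ChartDoubleBar
open B15AveragingHolomorphic (eml_star_inv mlog_star_inv)

variable {P : Params} {N : ℕ}

/-! ## §1 The involution `θ(a) = (a⁻¹)⋆` through the double-bar tower on `M_N(ℂ)ˣ`-fields (port of the `M₂(ℂ)` statements) -/

section Theta

open scoped Matrix.Norms.L2Operator

/-- `θ(1) = 1`. [folklore] -/
theorem theta_one : (((1 : (Matrix (Fin N) (Fin N) ℂ)ˣ)) : Matrix (Fin N) (Fin N) ℂ) =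
    star ((((1 : (Matrix (Fin N) (Fin N) ℂ)ˣ))⁻¹ : (Matrix (Fin N) (Fin N) ℂ)ˣ) : Matrix (Fin N) (Fin N) ℂ) := by
  rw [inv_one, Units.val_one, star_one]

/-- `θ(ab) = θ(a)θ(b)` (the two order reversals cancel). [folklore] -/
theorem theta_mul {a b a' b' : (Matrix (Fin N) (Fin N) ℂ)ˣ}
    (ha : (a' : Matrix (Fin N) (Fin N) ℂ) = star ((a⁻¹ : (Matrix (Fin N) (Fin N) ℂ)ˣ) : Matrix (Fin N) (Fin N) ℂ))
    (hb : (b' : Matrix (Fin N) (Fin N) ℂ) = star ((b⁻¹ : (Matrix (Fin N) (Fin N) ℂ)ˣ) : Matrix (Fin N) (Fin N) ℂ)) :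
    ((a' * b' : (Matrix (Fin N) (Fin N) ℂ)ˣ) : Matrix (Fin N) (Fin N) ℂ) = star (((a * b)⁻¹ : (Matrix (Fin N) (Fin N) ℂ)ˣ) : Matrix (Fin N) (Fin N) ℂ) := by
  rw [Units.val_mul, ha, hb, mul_inv_rev, Units.val_mul, star_mul]

/-- `θ(a⁻¹) = θ(a)⁻¹`. [folklore] -/
theorem theta_inv {a a' : (Matrix (Fin N) (Fin N) ℂ)ˣ}
    (ha : (a' : Matrix (Fin N) (Fin N) ℂ) = star ((a⁻¹ : (Matrix (Fin N) (Fin N) ℂ)ˣ) : Matrix (Fin N) (Fin N) ℂ)) :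
    ((a'⁻¹ : (Matrix (Fin N) (Fin N) ℂ)ˣ) : Matrix (Fin N) (Fin N) ℂ) = star (((a⁻¹)⁻¹ : (Matrix (Fin N) (Fin N) ℂ)ˣ) : Matrix (Fin N) (Fin N) ℂ) := by
  rw [inv_inv]
  refine Units.inv_eq_of_mul_eq_one_right ?_
  rw [ha, ← star_mul, ← Units.val_mul, mul_inv_cancel, Units.val_one, star_one]

/-- **`θ` THROUGH `exp[mean log]`** on a `1∕3`-small tuple (✓`eml_star_inv`), at the level of the units `(isUnit_eml ·).unit`. [cite: Balaban1987RG1, (0.4)-(0.5) p.253] -/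
theorem theta_emlUnit {W W' : Idx P → Matrix (Fin N) (Fin N) ℂ} (hW : ∀ i, ‖W i - 1‖ ≤ 1 / 3) (hθ : ∀ i, W' i = star ((W i)⁻¹)) :
    (((isUnit_eml W').unit : (Matrix (Fin N) (Fin N) ℂ)ˣ) : Matrix (Fin N) (Fin N) ℂ) =
      star ((((isUnit_eml W).unit)⁻¹ : (Matrix (Fin N) (Fin N) ℂ)ˣ) : Matrix (Fin N) (Fin N) ℂ) := by
  rw [IsUnit.unit_spec, Matrix.coe_units_inv, IsUnit.unit_spec]
  have hW' : W' = fun i => (star (W i))⁻¹ := funext fun i => by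
    rw [hθ i, Matrix.star_eq_conjTranspose, Matrix.star_eq_conjTranspose, Matrix.conjTranspose_nonsing_inv]
  rw [hW', eml_star_inv hW, Matrix.star_eq_conjTranspose, Matrix.star_eq_conjTranspose, Matrix.conjTranspose_nonsing_inv]

/-- **`e^{iηA(b)⋆} = θ(e^{iηA(b)})`**: the charted configuration of the adjoint field is the `θ`-image of the charted configuration (`(e^{X})⁻¹ = e^{−X}`, `(e^{X})⋆ = e^{X⋆}`,
`(iη)‾ = −iη`). [cite: Balaban1985Variational, (152) p.301, p.307] -/
theorem coe_expCfg_star (η : ℝ) (A : PBond P 0 → Matrix (Fin N) (Fin N) ℂ) (b : PBond P 0) :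
    ((expCfg η (fun b => star (A b)) b : (Matrix (Fin N) (Fin N) ℂ)ˣ) : Matrix (Fin N) (Fin N) ℂ) =
      star ((((expCfg η A b)⁻¹ : (Matrix (Fin N) (Fin N) ℂ)ˣ)) : Matrix (Fin N) (Fin N) ℂ) := by
  letI : NormedAlgebra ℚ (Matrix (Fin N) (Fin N) ℂ) := NormedAlgebra.restrictScalars ℚ ℂ _
  rw [Matrix.coe_units_inv, coe_expCfg, coe_expCfg, ← Matrix.exp_neg, star_exp, star_neg, star_smul, Complex.star_def, map_mul, Complex.conj_I,
    Complex.conj_ofReal, neg_mul, neg_smul, neg_neg]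

/-- **`Q_lin(A⋆) = Q_lin(A)⋆`**: the linear part `η·Lʲ·Q_j` of `Q♭` at the origin (CERT-2 ✓`fderiv_chartLogFlat_zero_apply`) has real coefficients. [cite: Balaban1985Variational, (48) p.285] -/
theorem fderiv_chartLogFlat_zero_star (η : ℝ) (D : Domains P) (Y : PBond P 0 → Matrix (Fin N) (Fin N) ℂ) (idx : BondIdx D) :
    fderiv ℂ (chartLogFlat η D : (PBond P 0 → Matrix (Fin N) (Fin N) ℂ) → BondIdx D → Matrix (Fin N) (Fin N) ℂ) 0 (fun b => star (Y b)) idx =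
      star (fderiv ℂ (chartLogFlat η D : (PBond P 0 → Matrix (Fin N) (Fin N) ℂ) → BondIdx D → Matrix (Fin N) (Fin N) ℂ) 0 Y idx) := by
  -- the entrywise adjoint as an `ℝ`-linear map
  let σ : Matrix (Fin N) (Fin N) ℂ →ₗ[ℝ] Matrix (Fin N) (Fin N) ℂ :=
    { toFun := fun M => star M
      map_add' := fun M N => star_add M N
      map_smul' := fun r M => by rw [star_smul, star_trivial, RingHom.id_apply] }
  have hσ : (fun b => star (Y b)) = fun b => σ (Y b) := rfl
  rw [fderiv_chartLogFlat_zero_apply, fderiv_chartLogFlat_zero_apply, hσ, ChartHInv.bondAvgIter_comp_apply σ, star_smul]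
  congr 1
  rw [Complex.star_def, map_mul, map_pow, Complex.conj_ofReal, map_natCast]

/-- **THE `hΨsa` ADAPTER (abstract (49) + uniqueness)**: if the remainder map `C` commutes with the entrywise adjoint at the dressed point `A′ − Hs Dv`, `Hs` commutes with it, `A′` is
bondwise self-adjoint and `Dv` is THE small solution of (49) `C(A′ − Hs Dv) = Dv` (uniqueness among data of size `≤ t`), then `Dv` is self-adjoint and so is the dressed field `A′ − Hs Dv`
(`Dv⋆` is a small solution too). [cite: Balaban1985Variational, (47)-(49) pp.285-286, p.307] -/
theorem isSelfAdjoint_dressed_of_unique {ι κ : Type*} (Hs : (κ → Matrix (Fin N) (Fin N) ℂ) → (ι → Matrix (Fin N) (Fin N) ℂ))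
    (hHs : ∀ X b, star (Hs X b) = Hs (fun c => star (X c)) b)
    (C : (ι → Matrix (Fin N) (Fin N) ℂ) → (κ → Matrix (Fin N) (Fin N) ℂ)) {A' : ι → Matrix (Fin N) (Fin N) ℂ} (hA' : ∀ b, IsSelfAdjoint (A' b))
    {Dv : κ → Matrix (Fin N) (Fin N) ℂ} {t : ℝ}
    (hC : C (fun b => star ((A' - Hs Dv) b)) = fun c => star (C (A' - Hs Dv) c))
    (h49 : C (A' - Hs Dv) = Dv) (hsize : ∀ c, ‖Dv c‖ ≤ t)
    (huniq : ∀ D' : κ → Matrix (Fin N) (Fin N) ℂ, (∀ c, ‖D' c‖ ≤ t) → C (A' - Hs D') = D' → D' = Dv) :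
    (∀ c, IsSelfAdjoint (Dv c)) ∧ ∀ b, IsSelfAdjoint ((A' - Hs Dv) b) := by
  -- the adjoint datum is a small solution too
  have hstar : ∀ D' : κ → Matrix (Fin N) (Fin N) ℂ, (fun b => star ((A' - Hs D') b)) = A' - Hs (fun c => star (D' c)) := fun D' =>
    funext fun b => by rw [Pi.sub_apply, Pi.sub_apply, star_sub, (hA' b).star_eq, hHs]
  have hsol : C (A' - Hs (fun c => star (Dv c))) = fun c => star (Dv c) := by
    rw [← hstar, hC, h49]
  have hfix : (fun c => star (Dv c)) = Dv := huniq _ (fun c => by rw [norm_star]; exact hsize c) hsol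
  have hDv : ∀ c, IsSelfAdjoint (Dv c) := fun c => congrFun hfix c
  refine ⟨hDv, fun b => ?_⟩
  show star ((A' - Hs Dv) b) = (A' - Hs Dv) b
  simpa only [hfix] using congrFun (hstar Dv) b

/-- a complex-cast real kernel commutes with the entrywise adjoint (the ♭ kernel of `H♭`, the kernels of `M_V`, `M♭`). [cite: Balaban1985Variational, (45) p.285] -/
theorem star_apply_of_realKernelC {ι κ : Type*} [Fintype κ] (Hs : (κ → Matrix (Fin N) (Fin N) ℂ) → (ι → Matrix (Fin N) (Fin N) ℂ)) (h : ι → κ → ℝ)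
    (hHs : ∀ X b, Hs X b = ∑ c, ((h b c : ℝ) : ℂ) • X c) (X : κ → Matrix (Fin N) (Fin N) ℂ) (b : ι) :
    star (Hs X b) = Hs (fun c => star (X c)) b := by
  rw [hHs, hHs, star_sum]
  exact Finset.sum_congr rfl fun c _ => by rw [star_smul, Complex.star_def, Complex.conj_ofReal]

variable [NeZero N]

/-- **ONE DOUBLE-BAR STEP COMMUTES WITH `θ`** on the two blocks of `c`: if `S′ = θ ∘ S` on the two-block bonds, which are within `s` of `1`, `12ℓs ≤ 1`, then
`U̿′(c) = θ(U̿(c))`. [cite: Balaban1985Averaging, (89) p.31, (110) p.34; Balaban1987RG1, (0.4)-(0.5) p.253] -/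
theorem theta_dbarAvgU {j : ℕ} (hj : j + 1 ≤ P.m + P.K) {S S' : GaugeField P j (Matrix (Fin N) (Fin N) ℂ)ˣ} (c : PBond P (j + 1)) {s : ℝ} (hs0 : 0 ≤ s)
    (hℓs : 12 * (((P.d + 2) * P.L : ℕ) : ℝ) * s ≤ 1)
    (hS : ∀ b : PBond P j, (blockOf b.src = c.src ∨ blockOf b.src = c.tgt) → (blockOf b.tgt = c.src ∨ blockOf b.tgt = c.tgt) →
      ‖((S b : (Matrix (Fin N) (Fin N) ℂ)ˣ) : Matrix (Fin N) (Fin N) ℂ) - 1‖ ≤ s)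
    (hθ : ∀ b : PBond P j, (blockOf b.src = c.src ∨ blockOf b.src = c.tgt) → (blockOf b.tgt = c.src ∨ blockOf b.tgt = c.tgt) →
      ((S' b : (Matrix (Fin N) (Fin N) ℂ)ˣ) : Matrix (Fin N) (Fin N) ℂ) = star (((S b)⁻¹ : (Matrix (Fin N) (Fin N) ℂ)ˣ) : Matrix (Fin N) (Fin N) ℂ)) :
    ((dbarAvgU S' c : (Matrix (Fin N) (Fin N) ℂ)ˣ) : Matrix (Fin N) (Fin N) ℂ) = star (((dbarAvgU S c)⁻¹ : (Matrix (Fin N) (Fin N) ℂ)ˣ) : Matrix (Fin N) (Fin N) ℂ) := by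
  have hℓs0 : 0 ≤ (((P.d + 2) * P.L : ℕ) : ℝ) * s := by positivity
  have hℓs4 : 4 * (((P.d + 2) * P.L : ℕ) : ℝ) * s ≤ 1 := by linarith
  have hthird : 4 * (((P.d + 2) * P.L : ℕ) : ℝ) * s ≤ 1 / 3 := by linarith
  -- `θ` along walks that read related bonds
  have hwalk : ∀ (x : Site P j) (w : List (Letter P.d)),
      (∀ st ∈ walk x w, ((S' st.bond : (Matrix (Fin N) (Fin N) ℂ)ˣ) : Matrix (Fin N) (Fin N) ℂ) =
        star (((S st.bond)⁻¹ : (Matrix (Fin N) (Fin N) ℂ)ˣ) : Matrix (Fin N) (Fin N) ℂ)) →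
      ((holT S' x w : (Matrix (Fin N) (Fin N) ℂ)ˣ) : Matrix (Fin N) (Fin N) ℂ) = star (((holT S x w)⁻¹ : (Matrix (Fin N) (Fin N) ℂ)ˣ) : Matrix (Fin N) (Fin N) ℂ) :=
    fun x w hw => holT_rel_of_walk
      (fun (a a' : (Matrix (Fin N) (Fin N) ℂ)ˣ) => (a' : Matrix (Fin N) (Fin N) ℂ) = star ((a⁻¹ : (Matrix (Fin N) (Fin N) ℂ)ˣ) : Matrix (Fin N) (Fin N) ℂ))
      theta_one (fun _ _ _ _ ha hb => theta_mul ha hb) (fun _ _ ha => theta_inv ha) S S' x w hw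
  -- the frames at the two ends
  have hframe : ∀ y : Site P (j + 1), (y = c.src ∨ y = c.tgt) →
      ((vframeU S' y : (Matrix (Fin N) (Fin N) ℂ)ˣ) : Matrix (Fin N) (Fin N) ℂ) = star (((vframeU S y)⁻¹ : (Matrix (Fin N) (Fin N) ℂ)ˣ) : Matrix (Fin N) (Fin N) ℂ) := by
    intro y hy
    have hSy : ∀ b : PBond P j, blockOf b.src = y → blockOf b.tgt = y → ‖((S b : (Matrix (Fin N) (Fin N) ℂ)ˣ) : Matrix (Fin N) (Fin N) ℂ) - 1‖ ≤ s := by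
      intro b hb1 hb2
      refine hS b ?_ ?_
      · rw [hb1]; exact hy
      · rw [hb2]; exact hy
    refine theta_emlUnit (fun i => ((norm_holT_stair_sub_one_le hj y hs0 hℓs4 hSy i).1).trans hthird) fun i => ?_
    rw [← Matrix.coe_units_inv]
    refine hwalk _ _ fun st hst => hθ st.bond ?_ ?_
    · rw [(blockOf_ends_of_mem_stairWalk hj y i.1 i.2.1 st hst).1]; exact hy
    · rw [(blockOf_ends_of_mem_stairWalk hj y i.1 i.2.1 st hst).2]; exact hy
  -- the single-bar average: `eml` of the loops times the straight transporter
  have havg : ((emlAvgU S' c : (Matrix (Fin N) (Fin N) ℂ)ˣ) : Matrix (Fin N) (Fin N) ℂ) =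
      star (((emlAvgU S c)⁻¹ : (Matrix (Fin N) (Fin N) ℂ)ˣ) : Matrix (Fin N) (Fin N) ℂ) := by
    unfold emlAvgU
    refine theta_mul (theta_emlUnit (fun i => ((norm_loopHolU_sub_one_le hj c hs0 hℓs4 hS i).1).trans hthird) fun i => ?_) ?_
    · rw [← Matrix.coe_units_inv]
      exact hwalk _ _ fun st hst => hθ st.bond (two_block_of_mem_loopWalk hj c i hst).1 (two_block_of_mem_loopWalk hj c i hst).2
    · exact hwalk _ _ fun st hst => hθ st.bond (two_block_of_mem_lineWalk hj c hst).1 (two_block_of_mem_lineWalk hj c hst).2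
  rw [dbarAvgU_apply, dbarAvgU_apply]
  exact theta_mul (theta_mul (theta_inv (hframe c.src (Or.inl rfl))) havg) (hframe c.tgt (Or.inr rfl))

/-- **THE DOUBLE-BAR TOWER COMMUTES WITH `θ` ON THE READ TERRITORY**: if `U′ = θ ∘ U` and `U` is within `s₀` of `1` on every fine bond whose level-`i` blocks lie in `S`,
`30400·ℓ²·Lⁱ·s₀ ≤ 1`, then `U̿′^{(i)}(e) = θ(U̿^{(i)}(e))` for every `e` with both ends in `S`. [cite: Balaban1985Averaging, Prop. 4 (134)-(135) p.38; Balaban1987RG1, (0.5) p.253] -/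
theorem theta_dbarIterU_of_reads :
    ∀ (i : ℕ), i ≤ P.m + P.K → ∀ (S : Set (Site P i)) (U U' : GaugeField P 0 (Matrix (Fin N) (Fin N) ℂ)ˣ) (s₀ : ℝ), 0 ≤ s₀ →
      8 * 3800 * (((P.d + 2) * P.L : ℕ) : ℝ) ^ 2 * (P.L : ℝ) ^ i * s₀ ≤ 1 →
      (∀ b : PBond P 0, iterBlockOf i b.src ∈ S → iterBlockOf i b.tgt ∈ S → ‖((U b : (Matrix (Fin N) (Fin N) ℂ)ˣ) : Matrix (Fin N) (Fin N) ℂ) - 1‖ ≤ s₀) →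
      (∀ b : PBond P 0, iterBlockOf i b.src ∈ S → iterBlockOf i b.tgt ∈ S →
        ((U' b : (Matrix (Fin N) (Fin N) ℂ)ˣ) : Matrix (Fin N) (Fin N) ℂ) = star (((U b)⁻¹ : (Matrix (Fin N) (Fin N) ℂ)ˣ) : Matrix (Fin N) (Fin N) ℂ)) →
      ∀ e : PBond P i, e.src ∈ S → e.tgt ∈ S →
        ((dbarIterU i U' e : (Matrix (Fin N) (Fin N) ℂ)ˣ) : Matrix (Fin N) (Fin N) ℂ) = star (((dbarIterU i U e)⁻¹ : (Matrix (Fin N) (Fin N) ℂ)ˣ) : Matrix (Fin N) (Fin N) ℂ) := by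
  set ℓ : ℝ := (((P.d + 2) * P.L : ℕ) : ℝ) with hℓ
  have hℓ1 : (1 : ℝ) ≤ ℓ := by
    rw [hℓ]; exact_mod_cast Nat.one_le_iff_ne_zero.mpr (Nat.mul_ne_zero (by omega) (by have := P.hL.2; omega))
  have hL1 : (1 : ℝ) ≤ P.L := by exact_mod_cast P.L_pos
  intro i
  induction i with
  | zero =>
    intro _ S U U' s₀ _ _ _ hθ e hs ht
    rw [dbarIterU_zero, dbarIterU_zero]
    exact hθ e (by simpa only [iterBlockOf_zero] using hs) (by simpa only [iterBlockOf_zero] using ht)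
  | succ i ih =>
    intro hi S U U' s₀ hs₀ hbudget hU hθ c hcs hct
    have hbudget_i : 8 * 3800 * ℓ ^ 2 * (P.L : ℝ) ^ i * s₀ ≤ 1 := by
      refine le_trans ?_ hbudget
      have : (P.L : ℝ) ^ i ≤ (P.L : ℝ) ^ (i + 1) := pow_le_pow_right₀ hL1 (Nat.le_succ i)
      have h0 : 0 ≤ 8 * 3800 * ℓ ^ 2 * s₀ := by positivity
      nlinarith
    set S' : Set (Site P i) := {y | blockOf y ∈ S} with hS'
    have hU' : ∀ b : PBond P 0, iterBlockOf i b.src ∈ S' → iterBlockOf i b.tgt ∈ S' →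
        ‖((U b : (Matrix (Fin N) (Fin N) ℂ)ˣ) : Matrix (Fin N) (Fin N) ℂ) - 1‖ ≤ s₀ :=
      fun b hs ht => hU b (by rw [iterBlockOf_succ]; exact hs) (by rw [iterBlockOf_succ]; exact ht)
    have hθ' : ∀ b : PBond P 0, iterBlockOf i b.src ∈ S' → iterBlockOf i b.tgt ∈ S' →
        ((U' b : (Matrix (Fin N) (Fin N) ℂ)ˣ) : Matrix (Fin N) (Fin N) ℂ) = star (((U b)⁻¹ : (Matrix (Fin N) (Fin N) ℂ)ˣ) : Matrix (Fin N) (Fin N) ℂ) :=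
      fun b hs ht => hθ b (by rw [iterBlockOf_succ]; exact hs) (by rw [iterBlockOf_succ]; exact ht)
    have hF : ∀ e : PBond P i, e.src ∈ S' → e.tgt ∈ S' →
        ((dbarIterU i U' e : (Matrix (Fin N) (Fin N) ℂ)ˣ) : Matrix (Fin N) (Fin N) ℂ) = star (((dbarIterU i U e)⁻¹ : (Matrix (Fin N) (Fin N) ℂ)ˣ) : Matrix (Fin N) (Fin N) ℂ) :=
      ih (Nat.le_of_succ_le hi) S' U U' s₀ hs₀ hbudget_i hU' hθ'
    have hnear : ∀ e : PBond P i, e.src ∈ S' → e.tgt ∈ S' →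
        ‖((dbarIterU i U e : (Matrix (Fin N) (Fin N) ℂ)ˣ) : Matrix (Fin N) (Fin N) ℂ) - 1‖ ≤ 2 * ((P.L : ℝ) ^ i * s₀) :=
      fun e hs ht => norm_dbarIterU_sub_one_le_two_mul₀ (Nat.le_of_succ_le hi) S' U hs₀ hbudget_i hU' e hs ht
    rw [dbarIterU_succ, dbarIterU_succ]
    have hmem : ∀ b : PBond P i, (blockOf b.src = c.src ∨ blockOf b.src = c.tgt) → (blockOf b.tgt = c.src ∨ blockOf b.tgt = c.tgt) →
        b.src ∈ S' ∧ b.tgt ∈ S' := by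
      intro b hbs hbt
      exact ⟨show blockOf b.src ∈ S by rcases hbs with h | h <;> rw [h]; exacts [hcs, hct],
        show blockOf b.tgt ∈ S by rcases hbt with h | h <;> rw [h]; exacts [hcs, hct]⟩
    have h2x : 0 ≤ 2 * ((P.L : ℝ) ^ i * s₀) := by positivity
    have h12 : 12 * (((P.d + 2) * P.L : ℕ) : ℝ) * (2 * ((P.L : ℝ) ^ i * s₀)) ≤ 1 := by
      rw [← hℓ]
      have hx0 : 0 ≤ (P.L : ℝ) ^ i * s₀ := by positivity
      have hb' : 8 * 3800 * ℓ ^ 2 * ((P.L : ℝ) ^ i * s₀) ≤ 1 := by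
        have : 8 * 3800 * ℓ ^ 2 * ((P.L : ℝ) ^ i * s₀) = 8 * 3800 * ℓ ^ 2 * (P.L : ℝ) ^ i * s₀ := by ring
        rw [this]; exact hbudget_i
      nlinarith [mul_le_mul_of_nonneg_right hℓ1 (by positivity : (0 : ℝ) ≤ ℓ * ((P.L : ℝ) ^ i * s₀))]
    exact theta_dbarAvgU hi c h2x h12 (fun b hbs hbt => hnear b (hmem b hbs hbt).1 (hmem b hbs hbt).2)
      fun b hbs hbt => hF b (hmem b hbs hbt).1 (hmem b hbs hbt).2

/-! ## §2 The real structure of the double-bar chart -/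

/-- **`Q♭(A⋆)(j,c) = (Q♭(A)(j,c))⋆` (index form, guarded)**: for every field `A₀` whose charted bond variables read by the index `(j,c)` are within `s₀` of `1`,
`30400·ℓ²·Lʲ·s₀ ≤ 1` (`U̿^{(j)}(e^{iηA⋆}) = θ(U̿^{(j)}(e^{iηA}))`, `log((X⋆)⁻¹) = −(log X)⋆` by ✓`mlog_star_inv` on `‖X − 1‖ ≤ 1∕3`, `(−i)‾ = i`).
[cite: Balaban1985Variational, (20) p.281, p.307; Balaban1985Averaging, (23) p.21] -/
theorem chartLogFlat_star_of_reads (η : ℝ) (D : Domains P) (idx : BondIdx D) (A₀ : PBond P 0 → Matrix (Fin N) (Fin N) ℂ) {s₀ : ℝ} (hs₀ : 0 ≤ s₀)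
    (hbudget : 8 * 3800 * (((P.d + 2) * P.L : ℕ) : ℝ) ^ 2 * (P.L : ℝ) ^ (idx.1.1 : ℕ) * s₀ ≤ 1)
    (hA : ∀ b : PBond P 0, (iterBlockOf (idx.1.1 : ℕ) b.src = idx.1.2.src ∨ iterBlockOf (idx.1.1 : ℕ) b.src = idx.1.2.tgt) →
      (iterBlockOf (idx.1.1 : ℕ) b.tgt = idx.1.2.src ∨ iterBlockOf (idx.1.1 : ℕ) b.tgt = idx.1.2.tgt) →
      ‖((expCfg η A₀ b : (Matrix (Fin N) (Fin N) ℂ)ˣ) : Matrix (Fin N) (Fin N) ℂ) - 1‖ ≤ s₀) :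
    chartLogFlat η D (fun b => star (A₀ b)) idx = star (chartLogFlat η D A₀ idx) := by
  have hj : (idx.1.1 : ℕ) ≤ P.m + P.K := (Nat.lt_succ_iff.mp idx.1.1.isLt).trans D.hk
  set S : Set (Site P (idx.1.1 : ℕ)) := {y | y = idx.1.2.src ∨ y = idx.1.2.tgt} with hS
  have hA' : ∀ b : PBond P 0, iterBlockOf (idx.1.1 : ℕ) b.src ∈ S → iterBlockOf (idx.1.1 : ℕ) b.tgt ∈ S →
      ‖((expCfg η A₀ b : (Matrix (Fin N) (Fin N) ℂ)ˣ) : Matrix (Fin N) (Fin N) ℂ) - 1‖ ≤ s₀ := fun b hs ht => hA b hs ht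
  have hθ := theta_dbarIterU_of_reads (idx.1.1 : ℕ) hj S (expCfg η A₀) (expCfg η fun b => star (A₀ b)) s₀ hs₀ hbudget hA'
    (fun b _ _ => coe_expCfg_star η A₀ b) idx.1.2 (Or.inl rfl) (Or.inr rfl)
  have hnear := norm_dbarIterU_sub_one_le_two_mul₀ hj S (expCfg η A₀) hs₀ hbudget hA' idx.1.2 (Or.inl rfl) (Or.inr rfl)
  have hℓ1 : (1 : ℝ) ≤ (((P.d + 2) * P.L : ℕ) : ℝ) := by
    exact_mod_cast Nat.one_le_iff_ne_zero.mpr (Nat.mul_ne_zero (by omega) (by have := P.hL.2; omega))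
  have hthird : ‖((dbarIterU (idx.1.1 : ℕ) (expCfg η A₀) idx.1.2 : (Matrix (Fin N) (Fin N) ℂ)ˣ) : Matrix (Fin N) (Fin N) ℂ) - 1‖ ≤ 1 / 3 := by
    refine hnear.trans ?_
    have h0 : 0 ≤ (P.L : ℝ) ^ (idx.1.1 : ℕ) * s₀ := by positivity
    have h1 : 8 * 3800 * (((P.d + 2) * P.L : ℕ) : ℝ) ^ 2 * ((P.L : ℝ) ^ (idx.1.1 : ℕ) * s₀) ≤ 1 := by
      have : 8 * 3800 * (((P.d + 2) * P.L : ℕ) : ℝ) ^ 2 * ((P.L : ℝ) ^ (idx.1.1 : ℕ) * s₀) =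
          8 * 3800 * (((P.d + 2) * P.L : ℕ) : ℝ) ^ 2 * (P.L : ℝ) ^ (idx.1.1 : ℕ) * s₀ := by ring
      rw [this]; exact hbudget
    nlinarith [(one_le_pow₀ (M₀ := ℝ) hℓ1 : (1:ℝ) ≤ _ ^ 2)]
  rw [chartLogFlat_apply, chartLogFlat_apply, hθ, Matrix.coe_units_inv, Matrix.star_eq_conjTranspose, Matrix.conjTranspose_nonsing_inv,
    ← Matrix.star_eq_conjTranspose, mlog_star_inv hthird, star_smul, star_neg, Complex.star_def, Complex.conj_I, smul_neg, neg_smul, neg_neg, neg_neg]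

end Theta

/-! ## §3 The K0 carrier: the weighted ball of the (152) weights, the ♭ remainder, and the implicit ♭ chart at self-adjoint fields -/

section K0

variable [NeZero N]

open scoped Matrix.Norms.L2Operator
open Summit.QuantumFields.YangMills.BalabanUVNodes.N07ChartRemainderP (norm_expCfg_sub_one_le_of_weightedBall)
open Summit.QuantumFields.YangMills.Theorems.Chart47Analytic (size_shift_lt_of_size_le)
open Summit.QuantumFields.YangMills.Theorems.K0Stub1FlatChartRemainderP (chartRemainderFlat_hCd_hCq)

/-- ★★ **`Q♭(A⋆) = Q♭(A)⋆` ON THE WEIGHTED BALL OF THE (152) WEIGHTS, GENERIC CARRIER, FIBRE `M_N(ℂ)`**: for a nested `D` (`D.k = k`) with the collar property, the K0 level weights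
`w`, a radius with `60800·ℓ²·L·R ≤ 1` (`ℓ = (d+2)L`) and every `A` with `w₁(b)‖A b‖ < R`: `chartLogFlat η D (A⋆) (j,c) = (chartLogFlat η D A (j,c))⋆`, `η = L^{−k}` (§2 + n07-w2's
P-generic read-territory letter `norm_expCfg_sub_one_le_of_weightedBall`). [cite: Balaban1985Variational, (20) p.281, (44)-(47) p.285, p.307] -/
theorem chartLogFlat_star_weightedBall_P (k : ℕ) (D : Domains P) (hDk : D.k = k)
    (hcollar : ∀ (i : ℕ) (e : PBond P (i + 1)), D.LamBond (i + 1) e → ∀ z : Site P i, (blockOf z = e.src ∨ blockOf z = e.tgt) → z ∈ D.Om i)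
    {w : ℕ → PBond P 0 → ℝ} (hw : IsLevWeight P k D w)
    {R : ℝ} (hR : 16 * 3800 * (((P.d + 2) * P.L : ℕ) : ℝ) ^ 2 * (P.L : ℝ) * R ≤ 1)
    {A : PBond P 0 → Matrix (Fin N) (Fin N) ℂ} (hA : ∀ b, w 1 b * ‖A b‖ < R) (idx : BondIdx D) :
    chartLogFlat (((P.L : ℝ)⁻¹) ^ k) D (fun b => star (A b)) idx = star (chartLogFlat (((P.L : ℝ)⁻¹) ^ k) D A idx) := by
  have hL1 : (1 : ℝ) ≤ P.L := by exact_mod_cast P.L_pos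
  have hL0 : (0 : ℝ) < P.L := by linarith
  have hℓ1 : (1 : ℝ) ≤ (((P.d + 2) * P.L : ℕ) : ℝ) := by
    exact_mod_cast Nat.one_le_iff_ne_zero.mpr (Nat.mul_ne_zero (by omega) (by have := P.hL.2; omega))
  have hLj : 0 < (P.L : ℝ) ^ (idx.1.1 : ℕ) := by positivity
  have hR0 : 0 ≤ R := by
    have := hA (⟨fun _ => 0, idx.1.2.dir⟩ : PBond P 0)
    have hw0 : 0 ≤ w 1 ⟨fun _ => 0, idx.1.2.dir⟩ * ‖A ⟨fun _ => 0, idx.1.2.dir⟩‖ := by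
      rw [hw 1, pow_one]; exact mul_nonneg (by positivity) (norm_nonneg _)
    linarith
  have hR' : 12800 * (((P.d + 2) * P.L : ℕ) : ℝ) ^ 2 * (P.L : ℝ) * R ≤ 1 := by nlinarith [show 0 ≤ (((P.d + 2) * P.L : ℕ) : ℝ) ^ 2 * (P.L : ℝ) * R by positivity]
  set s₀ : ℝ := 2 * (P.L : ℝ) * R * ((P.L : ℝ) ^ (idx.1.1 : ℕ))⁻¹ with hs₀
  have hs₀0 : 0 ≤ s₀ := by positivity
  have hbudget : 8 * 3800 * (((P.d + 2) * P.L : ℕ) : ℝ) ^ 2 * (P.L : ℝ) ^ (idx.1.1 : ℕ) * s₀ ≤ 1 := by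
    have : 8 * 3800 * (((P.d + 2) * P.L : ℕ) : ℝ) ^ 2 * (P.L : ℝ) ^ (idx.1.1 : ℕ) * s₀ =
        16 * 3800 * (((P.d + 2) * P.L : ℕ) : ℝ) ^ 2 * (P.L : ℝ) * R := by
      rw [hs₀]; field_simp; ring
    rw [this]; exact hR
  have hA' : ∀ b : PBond P 0, (iterBlockOf (idx.1.1 : ℕ) b.src = idx.1.2.src ∨ iterBlockOf (idx.1.1 : ℕ) b.src = idx.1.2.tgt) →
      (iterBlockOf (idx.1.1 : ℕ) b.tgt = idx.1.2.src ∨ iterBlockOf (idx.1.1 : ℕ) b.tgt = idx.1.2.tgt) →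
      ‖((expCfg (((P.L : ℝ)⁻¹) ^ k) A b : (Matrix (Fin N) (Fin N) ℂ)ˣ) : Matrix (Fin N) (Fin N) ℂ) - 1‖ ≤ s₀ :=
    fun b hb _ => norm_expCfg_sub_one_le_of_weightedBall k D hDk hcollar hw hR' hA idx b hb
  exact chartLogFlat_star_of_reads (((P.L : ℝ)⁻¹) ^ k) D idx A hs₀0 hbudget hA'

/-- **`C♭(A⋆) = C♭(A)⋆` on that ball** (`C♭ = Q♭ − Q_lin♭`; §2's `fderiv_chartLogFlat_zero_star`). [cite: Balaban1985Variational, (44)-(49) p.285, p.307] -/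
theorem chartRemainderFlat_star_weightedBall_P (k : ℕ) (D : Domains P) (hDk : D.k = k)
    (hcollar : ∀ (i : ℕ) (e : PBond P (i + 1)), D.LamBond (i + 1) e → ∀ z : Site P i, (blockOf z = e.src ∨ blockOf z = e.tgt) → z ∈ D.Om i)
    {w : ℕ → PBond P 0 → ℝ} (hw : IsLevWeight P k D w)
    {R : ℝ} (hR : 16 * 3800 * (((P.d + 2) * P.L : ℕ) : ℝ) ^ 2 * (P.L : ℝ) * R ≤ 1)
    {A : PBond P 0 → Matrix (Fin N) (Fin N) ℂ} (hA : ∀ b, w 1 b * ‖A b‖ < R) :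
    (fun idx => chartLogFlat (((P.L : ℝ)⁻¹) ^ k) D (fun b => star (A b)) idx -
        fderiv ℂ (chartLogFlat (((P.L : ℝ)⁻¹) ^ k) D : (PBond P 0 → Matrix (Fin N) (Fin N) ℂ) → BondIdx D → Matrix (Fin N) (Fin N) ℂ) 0 (fun b => star (A b)) idx) =
      fun idx => star (chartLogFlat (((P.L : ℝ)⁻¹) ^ k) D A idx -
        fderiv ℂ (chartLogFlat (((P.L : ℝ)⁻¹) ^ k) D : (PBond P 0 → Matrix (Fin N) (Fin N) ℂ) → BondIdx D → Matrix (Fin N) (Fin N) ℂ) 0 A idx) := by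
  funext idx
  rw [chartLogFlat_star_weightedBall_P k D hDk hcollar hw hR hA idx, fderiv_chartLogFlat_zero_star, star_sub]

/-- ★★★ **THE IMPLICIT ♭ CHART AT SELF-ADJOINT FIELDS** (generic `P`, fibre `M_N(ℂ)`): for a nested `D` (`D.k = k`) admissible `Adm22 D R′ M` with `2L ≤ R′`, `1 ≤ M`, the (152) weights,
a ℂ-linear `H` with a REAL kernel and the sup (46) row `B₀`, FILE α's window (`9C₂♭B₀ε < 1`, `3ε ≤ R⋆♭∕4`, `0 < ε`) and a map `Dsel` with FILE α's spec on the `ε`-ball (ball bound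
`4C₂♭ε²`, (49)♭, uniqueness among small solutions): at every bondwise SELF-ADJOINT `A′` of the ball, `Dsel A′` and the dressed field `A′ − H(Dsel A′)` are bondwise self-adjoint
(§3 abstract adapter ∘ §4 `C♭(·⋆) = C♭(·)⋆` at the dressed point, which lies in the ball of radius `R⋆♭∕4` by UST `size_shift_lt_of_size_le`).
[cite: Balaban1985Variational, (47)-(49) pp.285-286, (55)-(57) p.286, p.307] -/
theorem isSelfAdjoint_chartDFlat (k : ℕ) (D : Domains P) (hDk : D.k = k) {R' Mb : ℕ} (hAdm : Adm22 D R' Mb) (hR'L : 2 * P.L ≤ R') (hMb : 1 ≤ Mb)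
    {w : ℕ → PBond P 0 → ℝ} (hw : IsLevWeight P k D w)
    (H : (BondIdx D → Matrix (Fin N) (Fin N) ℂ) →ₗ[ℂ] (PBond P 0 → Matrix (Fin N) (Fin N) ℂ)) (hker : PBond P 0 → BondIdx D → ℝ)
    (hH : ∀ (X : BondIdx D → Matrix (Fin N) (Fin N) ℂ) (b : PBond P 0), H X b = ∑ t, ((hker b t : ℝ) : ℂ) • X t)
    {B₀ : ℝ} (hHB : ∀ (X : BondIdx D → Matrix (Fin N) (Fin N) ℂ) (t : ℝ), 0 ≤ t → (∀ c, ‖X c‖ ≤ t) → ∀ b, w 1 b * ‖H X b‖ ≤ B₀ * t)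
    {ε : ℝ} (hε : 0 < ε)
    (hq : 9 * (64 * (P.L : ℝ) / (60800 * (((P.d + 2) * P.L : ℕ) : ℝ) ^ 2 * (P.L : ℝ))⁻¹) * B₀ * ε < 1)
    (h3ε : 3 * ε ≤ (60800 * (((P.d + 2) * P.L : ℕ) : ℝ) ^ 2 * (P.L : ℝ))⁻¹ / 4)
    (Dsel : (PBond P 0 → Matrix (Fin N) (Fin N) ℂ) → (BondIdx D → Matrix (Fin N) (Fin N) ℂ))
    (hDball : ∀ A' : PBond P 0 → Matrix (Fin N) (Fin N) ℂ, (∀ b, w 1 b * ‖A' b‖ < ε) →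
      ∀ c, ‖Dsel A' c‖ ≤ 4 * (64 * (P.L : ℝ) / (60800 * (((P.d + 2) * P.L : ℕ) : ℝ) ^ 2 * (P.L : ℝ))⁻¹) * ε ^ 2)
    (hDfix : ∀ A' : PBond P 0 → Matrix (Fin N) (Fin N) ℂ, (∀ b, w 1 b * ‖A' b‖ < ε) →
      chartLogFlat (((P.L : ℝ)⁻¹) ^ k) D (A' - H (Dsel A')) -
          (fderiv ℂ (chartLogFlat (((P.L : ℝ)⁻¹) ^ k) D : (PBond P 0 → Matrix (Fin N) (Fin N) ℂ) → BondIdx D → Matrix (Fin N) (Fin N) ℂ) 0) (A' - H (Dsel A'))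
        = Dsel A')
    (huniq : ∀ A' : PBond P 0 → Matrix (Fin N) (Fin N) ℂ, (∀ b, w 1 b * ‖A' b‖ < ε) → ∀ D' : BondIdx D → Matrix (Fin N) (Fin N) ℂ,
      (∀ c, ‖D' c‖ ≤ 4 * (64 * (P.L : ℝ) / (60800 * (((P.d + 2) * P.L : ℕ) : ℝ) ^ 2 * (P.L : ℝ))⁻¹) * ε ^ 2) →
      chartLogFlat (((P.L : ℝ)⁻¹) ^ k) D (A' - H D') -
          (fderiv ℂ (chartLogFlat (((P.L : ℝ)⁻¹) ^ k) D : (PBond P 0 → Matrix (Fin N) (Fin N) ℂ) → BondIdx D → Matrix (Fin N) (Fin N) ℂ) 0) (A' - H D') = D' →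
      D' = Dsel A')
    {A' : PBond P 0 → Matrix (Fin N) (Fin N) ℂ} (hA' : ∀ b, w 1 b * ‖A' b‖ < ε) (hsa : ∀ b, IsSelfAdjoint (A' b)) :
    (∀ c, IsSelfAdjoint (Dsel A' c)) ∧ ∀ b, IsSelfAdjoint ((A' - H (Dsel A')) b) := by
  classical
  set Rs : ℝ := (60800 * (((P.d + 2) * P.L : ℕ) : ℝ) ^ 2 * (P.L : ℝ))⁻¹ with hRs
  set C₂ : ℝ := 64 * (P.L : ℝ) / Rs with hC₂
  have hL0 : (0 : ℝ) < P.L := lt_of_lt_of_le one_pos (by exact_mod_cast P.L_pos)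
  have hℓ0 : (0 : ℝ) < (((P.d + 2) * P.L : ℕ) : ℝ) := by exact_mod_cast Nat.pos_of_ne_zero (Nat.mul_ne_zero (by omega) (by have := P.hL.2; omega))
  have hden : 0 < 60800 * (((P.d + 2) * P.L : ℕ) : ℝ) ^ 2 * (P.L : ℝ) := by positivity
  have hC₂0 : 0 ≤ C₂ := div_nonneg (by positivity) (inv_pos.mpr hden).le
  have hw1pos : ∀ b : PBond P 0, 0 < w 1 b := fun b => by rw [hw 1 b, pow_one]; positivity
  have hRM : 2 * P.L ≤ R' * Mb + 1 := by have : R' ≤ R' * Mb := Nat.le_mul_of_pos_right R' hMb; omega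
  have hcollar := collar_of_adm22 D hAdm hRM
  -- a size `r < ε` of `A′` (finite max)
  obtain ⟨b₁, -, hmax⟩ := Finset.exists_max_image Finset.univ (fun b' : PBond P 0 => w 1 b' * ‖A' b'‖) ⟨⟨fun _ => 0, ⟨0, P.hd⟩⟩, Finset.mem_univ _⟩
  have hsize : ∀ b', w 1 b' * ‖A' b'‖ ≤ w 1 b₁ * ‖A' b₁‖ := fun b' => hmax b' (Finset.mem_univ b')
  -- the dressed point lies in the ball of radius `R⋆♭∕4` (UST `size_shift_lt_of_size_le` with FILE α's chart data)
  have hHw : ∀ (X : BondIdx D → Matrix (Fin N) (Fin N) ℂ) (t : ℝ), 0 ≤ t → (∀ c, (fun _ : BondIdx D => (1 : ℝ)) c * ‖X c‖ ≤ t) →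
      ∀ b, w 1 b * ‖H X b‖ ≤ B₀ * t := fun X t ht hX b => hHB X t ht (fun c => by simpa only [one_mul] using hX c) b
  have hDball' : ∀ A'' : PBond P 0 → Matrix (Fin N) (Fin N) ℂ, (∀ b', w 1 b' * ‖A'' b'‖ < ε) →
      ∀ c, (fun _ : BondIdx D => (1 : ℝ)) c * ‖Dsel A'' c‖ ≤ 4 * C₂ * ε ^ 2 := fun A'' hA'' c => by rw [one_mul]; exact hDball A'' hA'' c
  have hΦ : ∀ b', w 1 b' * ‖(A' - H (Dsel A')) b'‖ < Rs / 4 :=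
    size_shift_lt_of_size_le (w₀ := w 1) (wB := fun _ => (1 : ℝ)) hw1pos H hC₂0 hHw hq hε Dsel hDball' h3ε A' _ (hA' b₁) hsize
  -- the window of §4 at radius `R⋆♭∕4`: `60800ℓ²L·(R⋆♭∕4) = 1∕4 ≤ 1`
  have hRwin : 16 * 3800 * (((P.d + 2) * P.L : ℕ) : ℝ) ^ 2 * (P.L : ℝ) * (Rs / 4) ≤ 1 := by
    rw [show 16 * 3800 * (((P.d + 2) * P.L : ℕ) : ℝ) ^ 2 * (P.L : ℝ) * (Rs / 4) = (60800 * (((P.d + 2) * P.L : ℕ) : ℝ) ^ 2 * (P.L : ℝ) * Rs) / 4 by ring,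
      hRs, mul_inv_cancel₀ hden.ne']; norm_num
  have hC := chartRemainderFlat_star_weightedBall_P (N := N) k D hDk hcollar hw hRwin hΦ
  have hHs : ∀ (X : BondIdx D → Matrix (Fin N) (Fin N) ℂ) (b : PBond P 0), star (H X b) = H (fun c => star (X c)) b :=
    fun X b => star_apply_of_realKernelC (fun X => H X) hker (fun X b => hH X b) X b
  exact isSelfAdjoint_dressed_of_unique (fun X => H X) hHs
    (fun A : PBond P 0 → Matrix (Fin N) (Fin N) ℂ => chartLogFlat (((P.L : ℝ)⁻¹) ^ k) D A -
      (fderiv ℂ (chartLogFlat (((P.L : ℝ)⁻¹) ^ k) D : (PBond P 0 → Matrix (Fin N) (Fin N) ℂ) → BondIdx D → Matrix (Fin N) (Fin N) ℂ) 0) A)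
    hsa hC (hDfix A' hA') (hDball A' hA') (huniq A' hA')

end K0

end Summit.QuantumFields.YangMills.Theorems.K0Stub1FlatChartStar

end
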